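import Summits.CriticalPhenomena.CardyFormulaZ2.Theorems.CardyIKTransportIKMixedBoxCrossingDefectStubColGlue
import Summits.CriticalPhenomena.CardyFormulaZ2.Theorems.CardyIKTransportIKMixedBoxCrossingDefectStubColFactorisation
import Summits.CriticalPhenomena.CardyFormulaZ2.Theorems.CardyIKTransportIKMixedBoxCrossingDefectStubGlueFirstPos

/-!
# Stub `stub_glueFirstColPos` of the line `defect-closure-exploration` (crux `IKMixedBoxCrossing`,
# stmt-CriticalPhenomena-5911)

POSITIVITY OF THE FIRST COLUMN-GLUE MOMENT: `0 < glueFirstCol S b n n` for every column pattern `S`, every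
scale `n ≥ 1` and every position `b` of the wide box `[-n, n] × [b, b+n)` cut by the anchor cell column `0`.
This is the transpose (rows ↔ columns) of the landed `stub_glueFirstPos`.

PROOF (finite energy, no literature fact).
* By the landed `ColFactorisation` (`stub_colFactorisation`) and `ColGlueStub.glueFirstCol_eq`,
  `glueFirstCol S b n n = Σ_j ν(E_j)` with the glue events `E_j = rtArm_j ∩ lfArm_j ∩ {(0, b+j) black}`;
  every term is nonnegative, so it suffices that one (in fact each) `E_j` has positive mass.
* ALL-BLACK ROW (`glue_of_row`): if the `2n+1` cells `(z, b+j)`, `-n ≤ z ≤ n`, are black then `E_j` holds —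
  the horizontal black runs `(1, b+j) … (n, b+j)` inside the right half-box and `(-1, b+j) … (-n, b+j)` inside
  the left half-box are open paths of the triangulation whatever the diagonals (`openConnIn_hseg`: horizontal
  neighbours are always edges), reaching the right column of `Rt` and the left column of `Lf`.
* FINITE ENERGY (`crsw_condBound_of_cellFlips` with the sharp single-cell flips `exists_cellFlip_sharp`):
  forcing the `2n+1` cells of the row black costs at most the factor `(2 · 16/9)^{2n+1}`, so
  `ν(E_j) ≥ (32/9)^{-(2n+1)} · ν(univ) = (32/9)^{-(2n+1)} > 0`.
-/

noncomputable section

namespace Summit.CriticalPhenomena.CardyFormulaZ2.Cruxes.IKMixedBoxCrossing.DefectClosureExploration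

open scoped BigOperators Classical
open MeasureTheory Finset
open Literature.Probability.Percolation Literature.Probability.LatticeModels
open Summit.CriticalPhenomena.CardyFormulaZ2.Theorems.IKLinearTransport.PinnedDiagramExchange
  (Obs νmix blackEdges determinedOn isProbabilityMeasure_nuMix crsw_condBound_of_cellFlips crsw_factor_props)
open Summit.CriticalPhenomena.CardyFormulaZ2.Theorems.IKLinearTransport.PinnedDiagramExchange.CouplingToLimits
  (mk_mem_blackEdges_iff)
open Summit.CriticalPhenomena.CardyFormulaZ2.Cruxes.IKMixedBoxCrossing.PairedMirrorExploration.FiniteEnergyStub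
  (exists_cellFlip_sharp)

namespace GlueFirstColPosStub

/-! ## §1 Horizontal black runs are open paths of every triangulation -/

/-- A horizontal segment of black cells `(y, c), (y+1, c), …, (y', c)` inside `X` joins its ends inside `X` in
the black-edge configuration (horizontal neighbours are edges of every triangulation). -/
theorem openConnIn_hseg (x : Obs) (X : Set (Site 2)) (c y y' : ℤ) (hyy' : y ≤ y')
    (hmem : ∀ z : ℤ, y ≤ z → z ≤ y' → (![z, c] : Site 2) ∈ X)
    (hbl : ∀ z : ℤ, y ≤ z → z ≤ y' → (![z, c] : Site 2) ∈ x.1) :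
    blackEdges x ∈ openConnIn X ![y, c] ![y', c] := by
  obtain ⟨m, rfl⟩ : ∃ m : ℕ, y' = y + m := ⟨(y' - y).toNat, by omega⟩
  clear hyy'
  induction m with
  | zero =>
    simp only [Nat.cast_zero, add_zero] at hmem ⊢
    exact openConnIn_refl (hmem y le_rfl le_rfl)
  | succ m ih =>
    have h1 : blackEdges x ∈ openConnIn X ![y, c] ![y + (m : ℕ), c] :=
      ih (fun z h1 h2 => hmem z h1 (by push_cast; omega)) (fun z h1 h2 => hbl z h1 (by push_cast; omega))
    have hu : (![y + (m : ℕ), c] : Site 2) ∈ X := hmem _ (by omega) (by push_cast; omega)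
    have hv : (![y + ((m + 1 : ℕ) : ℤ), c] : Site 2) ∈ X := hmem _ (by push_cast; omega) le_rfl
    have hub : (![y + (m : ℕ), c] : Site 2) ∈ x.1 := hbl _ (by omega) (by push_cast; omega)
    have hvb : (![y + ((m + 1 : ℕ) : ℤ), c] : Site 2) ∈ x.1 := hbl _ (by push_cast; omega) le_rfl
    have he : s(![y + (m : ℕ), c], ![y + ((m + 1 : ℕ) : ℤ), c]) ∈ blackEdges x :=
      (mk_mem_blackEdges_iff _ _ _).2
        (Or.inl ⟨hub, hvb, Or.inl (by
          ext j; fin_cases j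
          · simp
            omega
          · simp)⟩)
    have hne : (![y + (m : ℕ), c] : Site 2) ≠ ![y + ((m + 1 : ℕ) : ℤ), c] := fun e => by
      have := congrFun e 0
      simp only [Matrix.cons_val_zero] at this
      push_cast at this
      omega
    exact PlanarDuality.openConnIn_trans h1 (openConnIn_of_adj hu hv he hne)

/-! ## §2 An all-black row glues -/

/-- ALL-BLACK ROW: if the cells `(z, b+j)`, `-n ≤ z ≤ n`, are black then row `j` carries a right arm, a black
axis cell and a left arm. -/
theorem glue_of_row (b : ℤ) (n : ℕ) (hn : 1 ≤ n) (j : Fin n) (x : Obs)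
    (hrow : ∀ z : ℤ, -(n : ℤ) ≤ z → z ≤ n → (![z, b + j] : Site 2) ∈ x.1) :
    x ∈ rtArm b n n j ∩ lfArm b n n j ∩ {x | (![0, b + j] : Site 2) ∈ x.1} := by
  have hjk : (j : ℕ) < n := j.isLt
  refine ⟨⟨⟨hrow 1 (by omega) (by exact_mod_cast hn), ![1, b + j], rfl, ![(n : ℤ), b + j], ?_, ?_⟩,
    hrow (-1) (by omega) (by omega), ![-1, b + j], rfl, ![-(n : ℤ), b + j], ?_, ?_⟩,
    hrow 0 (by omega) (by omega)⟩
  · simp only [rtCol, Set.mem_setOf_eq, Matrix.cons_val_zero, Matrix.cons_val_one, Matrix.cons_val_fin_one,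
      true_and]
    omega
  · exact openConnIn_hseg x (rtBox b n n) (b + j) 1 n (by exact_mod_cast hn)
      (fun z h1 h2 => by
        simp only [rtBox, Set.mem_setOf_eq, Matrix.cons_val_zero, Matrix.cons_val_one, Matrix.cons_val_fin_one]
        omega)
      (fun z h1 h2 => hrow z (by omega) h2)
  · simp only [lfCol, Set.mem_setOf_eq, Matrix.cons_val_zero, Matrix.cons_val_one, Matrix.cons_val_fin_one,
      true_and]
    omega
  · rw [openConnIn_comm]
    exact openConnIn_hseg x (lfBox b n n) (b + j) (-(n : ℤ)) (-1) (by omega)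
      (fun z h1 h2 => by
        simp only [lfBox, Set.mem_setOf_eq, Matrix.cons_val_zero, Matrix.cons_val_one, Matrix.cons_val_fin_one]
        omega)
      (fun z h1 h2 => hrow z h1 (by omega))

/-! ## §3 Finite energy: the glue event of a row has positive mass -/

/-- POSITIVE MASS OF A GLUE ROW: `0 < ν(rtArm_j ∩ lfArm_j ∩ {(0, b+j) black})`, by finite energy applied to
the all-black cylinder of the `2n+1` cells `(z, b+j)`, `-n ≤ z ≤ n` (which implies the glue event,
`glue_of_row`): forcing them black costs at most the finite factor `(2 · 16/9)^{2n+1}`. -/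
theorem glue_real_pos (S : Set ℤ) (b : ℤ) (n : ℕ) (hn : 1 ≤ n) (j : Fin n) :
    0 < (νmix S).real (rtArm b n n j ∩ lfArm b n n j ∩ {x | (![0, b + j] : Site 2) ∈ x.1}) := by
  haveI := isProbabilityMeasure_nuMix S
  -- the row cells, as a finite set of cells off `Λ = ∅`
  set B : Finset (Site 2) := (Finset.Icc (-(n : ℤ)) n).image fun z : ℤ => (![z, b + j] : Site 2)
  have hdet : (Set.univ : Set Obs) ∈ determinedOn (∅ : Set (Site 2)) :=
    fun _ _ _ => ⟨fun _ => Set.mem_univ _, fun _ => Set.mem_univ _⟩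
  have hBC : ∀ x : Obs, (∀ c ∈ B, c ∈ x.1) →
      x ∈ rtArm b n n j ∩ lfArm b n n j ∩ {x | (![0, b + j] : Site 2) ∈ x.1} :=
    fun x hx => glue_of_row b n hn j x fun z h1 h2 =>
      hx _ (Finset.mem_image_of_mem _ (Finset.mem_Icc.2 ⟨h1, h2⟩))
  have key := crsw_condBound_of_cellFlips exists_cellFlip_sharp ENNReal.ofReal_ne_top S MeasurableSet.univ hdet
    B (fun c _ => Set.notMem_empty c) hBC le_rfl
  obtain ⟨-, -, hMpos⟩ := crsw_factor_props exists_cellFlip_sharp ENNReal.ofReal_ne_top B.card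
  rw [probReal_univ, mul_one, Set.univ_inter] at key
  exact (inv_pos.2 hMpos).trans_le key

end GlueFirstColPosStub

/-- **Registered stub `stub_glueFirstColPos`** (line `defect-closure-exploration`, reshape v3c-b): the first
column-glue moment of the `(2n+1) × n` wide box across the anchor cell column `0` is positive for every pattern,
scale `n ≥ 1` and position — by `ColFactorisation` it is the sum of the masses of the glue events
`rtArm_j ∩ lfArm_j ∩ {(0,b+j) black}`, each of which contains the all-black row cylinder of row `j`, of positive
mass by finite energy. Transpose of `stub_glueFirstPos`. -/
theorem stub_glueFirstColPos : ∀ (S : Set ℤ) (n : ℕ) (b : ℤ), 1 ≤ n → 0 < glueFirstCol S b n n := by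
  intro S n b hn
  rw [ColGlueStub.glueFirstCol_eq stub_colFactorisation]
  exact sum_pos (fun j _ => GlueFirstColPosStub.glue_real_pos S b n hn j) ⟨⟨0, hn⟩, mem_univ _⟩

end Summit.CriticalPhenomena.CardyFormulaZ2.Cruxes.IKMixedBoxCrossing.DefectClosureExploration

end
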